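import Mathlib
import HarnessLib
import Literature.Probability.MarkovChains.MetropolisHastings
import Summits.Ventures.LatticeQCDFlow.Exactness.NoisyAcceptBias

/-!
# LatticeQCDFlow / Exactness — an independence sampler run with a COMPUTED proposal density is
# exact for the tilted law `π · q / q̂`, and for `π` only when `q̂ ∝ q`

HONEST FRAMING: exact (Metropolis-corrected) sampling algorithms for lattice gauge theory;
figures of merit are autocorrelation/cost numbers at stated couplings and volumes; no
continuum-physics claim.

Venture `LatticeQCDFlow` (cell pub-lqcd), topic `Exactness`; landed by FANOUT row 38 (r2-scope,
gen 3) as the Lean face of requirement E9 of HOME/R2-SCOPE.md v1.0.6 ("the proposal density that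
enters the importance weight `p/q` must be the exact density of the map actually applied, up to a
constant") and of the planted controls X-2 ("log-det dropped") and X-5c (regulator left in the
accept step) of HOME/FITNESS.md §5.  NEW WORK of the cell (elementary finite arithmetic), not a
published result; printed counterparts are named in docstrings only.

Setting.  Independence Metropolis (flow-MCMC): proposals `y ∼ q`, where `q` is the TRUE law of the
sampler's output, target `π`, acceptance `min {1, w(y)/w(x)}` with `w = π/q`.  In practice `q` is
replaced by a COMPUTED density `q̂` ("`qc`" below), for instance
(i) the prior density pushed through the map WITHOUT its Jacobian (control X-2);
(ii) for continuous-time flows and diffusion-model probability-flow ODEs, the instantaneous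
change-of-variables formula integrated along a DISCRETISED (Euler / Runge–Kutta) trajectory — the
log-Jacobian of the continuum flow, not of the discrete map that produced the sample (the exact
alternative, Lüscher CMP 293 (2010) §5, is the ordered product of the one-link Euler-step
Jacobians of the map as applied);
(iii) a regulated or truncated operator inside `π` (control X-5c: the same algebra with the misfit
moved from `q` to `π`).
STOCHASTIC misfits (Hutchinson trace estimates of a divergence, noisy log-determinants) are the
subject of `NoisyLogDetBias.lean`; this file is the deterministic case, where chain mode and
reweight mode turn out to sample the SAME wrong law.

Results (all proved; `X` finite, all densities positive):
* `imhComputedRate`, `imhComputedKernel` — the chain as RUN; `imhComputedRate_eq_mhRate`: it IS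
  the Metropolis–Hastings chain (`Literature.Probability.MarkovChains.mhKernel`) for the TILTED
  weight `tilted q qc π = π · q / qc`; hence `imhComputed_detailedBalance_tilted`,
  `imhComputed_isStationary_tilted` (exact — for the wrong law) and
  `imhComputed_isStationary_of_prop`: if `qc = c · q` (density exact up to a constant, e.g. an
  unnormalised model) the chain is exact for `π`.
* `tilted_normalised_eq_reweightLaw`: self-normalised reweighting of `q`-samples with the
  computed weights `π/qc` converges to `E_q[(π/qc) O] / E_q[π/qc]`, the expectation under
  `π · (q/qc)` normalised — literally `noisyReweightLaw π (q/qc)` of `NoisyLogDetBias.lean` (the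
  limit law there, with the deterministic factor `m = q/qc`) — which is the normalised tilted law:
  for a deterministic density error the two exactness modes have one and the same bias law, and
  only the SPREAD of `q/qc` over states matters.
* THE WITNESS (`Fin 2`): `π₂ = (1/3, 2/3)` (from `NoisyAcceptBias.lean`), `q` uniform, computed
  density `qc₂ = (2/5, 3/5)` (a 20 % density error of opposite sign on the two states): rates
  `1/2` and `3/8` (`imhComputedRate₂_zero_one`, `imhComputedRate₂_one_zero`),
  `imhComputed₂_not_stationary`, `imhComputed₂_stationary_biased : IsStationary (3/7, 4/7)`,
  relative bias `2/7 ≈ 29 %` on state `0` (`imhComputed₂_relative_bias`), and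
  `imhComputed₂_reweightLaw` (the reweighting limit is the same `(3/7, 4/7)`).
(`π₂` and its unfolding lemmas are imported from `NoisyAcceptBias.lean`.)

* THE AUDIT BOUND (append 1): `sum_abs_tilted_sub_le` — if `m ≤ q/qc ≤ M` then the normalised
  tilted law is within `M/m − 1` of `π` in `ℓ¹`; `sum_abs_tilted_sub_le_exp` — the log form,
  `|log (q/qc)| ≤ δ ⇒ ℓ¹ ≤ e^{2δ} − 1`: a uniform bound on the computed-log-density error is a
  bias ceiling for every bounded observable (both exactness modes), never exactness.

Use: a scorer cannot repair a mis-computed `q̂` after the fact — the Metropolis step "corrects"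
the model only relative to the density it is given.  The size of the bias is set by the spread of
`log q − log q̂` over the ensemble (an extensive quantity for a lattice flow), which is what an
audit must bound (R2-SCOPE.md §3 E9: step-halving / exact-Jacobian evidence).
-/

namespace Summit.Ventures.LatticeQCDFlow.Exactness

open Finset
open Literature.Probability.MarkovChains

/-! ## The computed-density independence chain on a finite space -/

section General

variable {X : Type*} [Fintype X] [DecidableEq X]

/-- Off-diagonal rate of the independence sampler AS RUN: propose `y` from the true output law `q`,
accept with `min {1, (π y / qc y) / (π x / qc x)}` where `qc` is the COMPUTED proposal density.
[folklore] -/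
noncomputable def imhComputedRate (q qc π : X → ℝ) (x y : X) : ℝ :=
  q y * min 1 ((π y / qc y) / (π x / qc x))

/-- Row kernel of the computed-density independence sampler (diagonal = rejected + self-proposed
mass). [folklore] -/
noncomputable def imhComputedKernel (q qc π : X → ℝ) (x y : X) : ℝ :=
  if y = x then 1 - ∑ z ∈ univ.erase x, imhComputedRate q qc π x z
  else imhComputedRate q qc π x y

/-- The law the computed-density chain actually targets: the TILTED weight `π · q / qc`
(unnormalised). [folklore] -/
noncomputable def tilted (q qc π : X → ℝ) (x : X) : ℝ := π x * q x / qc x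

omit [Fintype X] [DecidableEq X] in
/-- The tilted weight is positive. [folklore] -/
theorem tilted_pos {q qc π : X → ℝ} (hq : ∀ x, 0 < q x) (hqc : ∀ x, 0 < qc x)
    (hπ : ∀ x, 0 < π x) (x : X) : 0 < tilted q qc π x :=
  div_pos (mul_pos (hπ x) (hq x)) (hqc x)

/-- Off the diagonal, the kernel entries are the rates. [folklore] -/
theorem imhComputedKernel_of_ne (q qc π : X → ℝ) {x y : X} (h : y ≠ x) :
    imhComputedKernel q qc π x y = imhComputedRate q qc π x y := if_neg h

/-- Diagonal entry: one minus the off-diagonal row mass. [folklore] -/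
theorem imhComputedKernel_self (q qc π : X → ℝ) (x : X) :
    imhComputedKernel q qc π x x = 1 - ∑ z ∈ univ.erase x, imhComputedRate q qc π x z :=
  if_pos rfl

omit [Fintype X] [DecidableEq X] in
/-- **Key identity.**  The computed-density rate IS the Metropolis–Hastings rate for the
independence proposal `q` and the TILTED weight `π · q / qc`:
`q y · min{1, (π y/qc y)/(π x/qc x)} = min {q y, (π y q y/qc y) · q x / (π x q x/qc x)}`.
[folklore] -/
theorem imhComputedRate_eq_mhRate {q qc π : X → ℝ} (hq : ∀ x, 0 < q x) (hqc : ∀ x, 0 < qc x)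
    (hπ : ∀ x, 0 < π x) (x y : X) :
    imhComputedRate q qc π x y = mhRate (fun _ z => q z) (tilted q qc π) x y := by
  unfold imhComputedRate mhRate tilted
  rw [(monotone_mul_left_of_nonneg (hq y).le).map_min, mul_one]
  congr 1
  have hqx := (hq x).ne'
  have hqy := (hq y).ne'
  have hcx := (hqc x).ne'
  have hcy := (hqc y).ne'
  have hπx := (hπ x).ne'
  have hπy := (hπ y).ne'
  field_simp

/-- The computed-density kernel IS the Metropolis–Hastings kernel of the tilted weight.
[folklore] -/
theorem imhComputedKernel_eq_mhKernel {q qc π : X → ℝ} (hq : ∀ x, 0 < q x)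
    (hqc : ∀ x, 0 < qc x) (hπ : ∀ x, 0 < π x) :
    imhComputedKernel q qc π = mhKernel (fun _ z => q z) (tilted q qc π) := by
  funext x y
  simp only [imhComputedKernel, mhKernel, imhComputedRate_eq_mhRate hq hqc hπ]

/-- Rows of the computed-density kernel sum to one (it is a bona fide Markov kernel whatever
`qc` is). [folklore] -/
theorem imhComputedKernel_sum_eq_one {q qc π : X → ℝ} (hq : ∀ x, 0 < q x)
    (hqc : ∀ x, 0 < qc x) (hπ : ∀ x, 0 < π x) (x : X) :
    ∑ y, imhComputedKernel q qc π x y = 1 := by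
  rw [imhComputedKernel_eq_mhKernel hq hqc hπ]
  exact mhKernel_sum_eq_one _ _ x

/-- **Exact — for the tilted law.**  The computed-density chain is in detailed balance with
`π · q / qc`. [folklore] -/
theorem imhComputed_detailedBalance_tilted {q qc π : X → ℝ} (hq : ∀ x, 0 < q x)
    (hqc : ∀ x, 0 < qc x) (hπ : ∀ x, 0 < π x) :
    DetailedBalance (tilted q qc π) (imhComputedKernel q qc π) := by
  rw [imhComputedKernel_eq_mhKernel hq hqc hπ]
  exact mhKernel_detailedBalance (tilted_pos hq hqc hπ) _

/-- The tilted law `π · q / qc` is stationary for the computed-density chain.  Read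
contrapositively: the chain samples `π` itself only in so far as `q/qc` is constant on the
support (next theorem; the witness below shows the failure is real). [folklore] -/
theorem imhComputed_isStationary_tilted {q qc π : X → ℝ} (hq : ∀ x, 0 < q x)
    (hqc : ∀ x, 0 < qc x) (hπ : ∀ x, 0 < π x) :
    IsStationary (tilted q qc π) (imhComputedKernel q qc π) := by
  rw [imhComputedKernel_eq_mhKernel hq hqc hπ]
  exact mhKernel_isStationary (tilted_pos hq hqc hπ) _

/-- **Exact for `π` when the computed density is right up to a constant** (`qc = c · q`, e.g. an
exactly computed but unnormalised model density, or an exact per-layer log-det with the prior's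
normalisation dropped): then `π` is stationary. [folklore] -/
theorem imhComputed_isStationary_of_prop {q qc π : X → ℝ} (hq : ∀ x, 0 < q x)
    (hπ : ∀ x, 0 < π x) {c : ℝ} (hc : 0 < c) (h : ∀ x, qc x = c * q x) :
    IsStationary π (imhComputedKernel q qc π) := by
  have hqc : ∀ x, 0 < qc x := fun x => by rw [h x]; exact mul_pos hc (hq x)
  have ht : ∀ x, tilted q qc π x = π x / c := fun x => by
    unfold tilted
    rw [h x, mul_div_mul_right _ _ (hq x).ne']
  have hs := imhComputed_isStationary_tilted hq hqc hπ
  intro y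
  have key := hs y
  simp_rw [ht, div_mul_eq_mul_div, ← sum_div] at key
  exact (div_left_inj' hc.ne').mp key

omit [DecidableEq X] in
/-- **Reweight mode samples the same tilted law.**  Self-normalised importance sampling of
`q`-draws with the computed weights `π/qc` converges to `E_q[(π/qc) O]/E_q[π/qc]`, i.e. to the
expectation under the law `π · (q/qc) / Σ π · (q/qc)` (this is `noisyReweightLaw π (q/qc)` of
`NoisyLogDetBias.lean`, the reweighting limit law with the deterministic factor `m = q/qc`),
which is the normalised tilted law.  So for a DETERMINISTIC density error the chain-mode and
reweight-mode biases coincide. [folklore] -/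
theorem tilted_normalised_eq_reweightLaw (q qc π : X → ℝ) (x : X) :
    tilted q qc π x / ∑ y, tilted q qc π y =
      π x * (q x / qc x) / ∑ y, π y * (q y / qc y) := by
  simp only [tilted, mul_div_assoc]

end General

/-! ## The witness: a 20 % density error on two states -/

section Witness

/-- The sampler's TRUE output law in the witness: uniform on two states. [folklore] -/
noncomputable def u₂ : Fin 2 → ℝ := fun _ => 1 / 2

/-- The COMPUTED (mis-specified) proposal density `(2/5, 3/5)`. [folklore] -/
noncomputable def qc₂ : Fin 2 → ℝ := ![2 / 5, 3 / 5]

/-- Unfolding of `u₂`. [folklore] -/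
@[simp] theorem u₂_apply (x : Fin 2) : u₂ x = 1 / 2 := rfl

/-- Unfolding of `qc₂ 0`. [folklore] -/
@[simp] theorem qc₂_zero : qc₂ 0 = 2 / 5 := rfl

/-- Unfolding of `qc₂ 1`. [folklore] -/
@[simp] theorem qc₂_one : qc₂ 1 = 3 / 5 := rfl

/-- Positivity of the three laws of the witness. [folklore] -/
theorem u₂_pos (x : Fin 2) : 0 < u₂ x := by simp

/-- [folklore] -/
theorem qc₂_pos (x : Fin 2) : 0 < qc₂ x := by fin_cases x <;> simp

/-- [folklore] -/
theorem π₂_pos (x : Fin 2) : 0 < π₂ x := by fin_cases x <;> simp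

/-- Rate `0 → 1`: `(1/2) · min{1, (2/3)/(3/5) / ((1/3)/(2/5))} = (1/2) · min{1, 4/3} = 1/2`.
[folklore] -/
theorem imhComputedRate₂_zero_one : imhComputedRate u₂ qc₂ π₂ 0 1 = 1 / 2 := by
  simp only [imhComputedRate, u₂_apply, qc₂_zero, qc₂_one, π₂_zero, π₂_one]
  norm_num [min_def]

/-- Rate `1 → 0`: `(1/2) · min{1, 3/4} = 3/8`. [folklore] -/
theorem imhComputedRate₂_one_zero : imhComputedRate u₂ qc₂ π₂ 1 0 = 3 / 8 := by
  simp only [imhComputedRate, u₂_apply, qc₂_zero, qc₂_one, π₂_zero, π₂_one]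
  norm_num [min_def]

/-- `univ.erase 0 = {1}` in `Fin 2` (private helper). [folklore] -/
private theorem erase_zero₂' : (univ : Finset (Fin 2)).erase 0 = {1} := by decide

/-- `univ.erase 1 = {0}` in `Fin 2` (private helper). [folklore] -/
private theorem erase_one₂' : (univ : Finset (Fin 2)).erase 1 = {0} := by decide

/-- The four entries of the witness kernel: `K 0 1 = 1/2, K 1 0 = 3/8, K 0 0 = 1/2, K 1 1 = 5/8`.
[folklore] -/
theorem imhComputedKernel₂_entries :
    imhComputedKernel u₂ qc₂ π₂ 0 1 = 1 / 2 ∧ imhComputedKernel u₂ qc₂ π₂ 1 0 = 3 / 8 ∧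
      imhComputedKernel u₂ qc₂ π₂ 0 0 = 1 / 2 ∧ imhComputedKernel u₂ qc₂ π₂ 1 1 = 5 / 8 := by
  refine ⟨?_, ?_, ?_, ?_⟩
  · rw [imhComputedKernel_of_ne _ _ _ (by decide), imhComputedRate₂_zero_one]
  · rw [imhComputedKernel_of_ne _ _ _ (by decide), imhComputedRate₂_one_zero]
  · rw [imhComputedKernel_self, erase_zero₂', sum_singleton, imhComputedRate₂_zero_one]; norm_num
  · rw [imhComputedKernel_self, erase_one₂', sum_singleton, imhComputedRate₂_one_zero]; norm_num

/-- **A computed-density independence sampler is NOT exact**: with a 20 % error in the model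
density, `π₂ = (1/3, 2/3)` is not stationary (flow into state `0`:
`(1/3)(1/2) + (2/3)(3/8) = 5/12 ≠ 1/3`).  Printed counterparts: for continuous flows "relying on
such an estimator will render importance weighing … useless" (Köhler–Klein–Noé, ICML 2020 §3,
of the Hutchinson-estimated density — the stochastic version); the exact treatment of a
discretised flow is the product of the step Jacobians of the map as applied (Lüscher, CMP 293
(2010) §5).  Venture result (controls X-2 / X-5c; requirement E9 of R2-SCOPE.md). [folklore] -/
theorem imhComputed₂_not_stationary : ¬ IsStationary π₂ (imhComputedKernel u₂ qc₂ π₂) := by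
  intro h
  have h0 := h 0
  obtain ⟨-, h10, h00, -⟩ := imhComputedKernel₂_entries
  rw [Fin.sum_univ_two, h00, h10, π₂_zero, π₂_one] at h0
  norm_num at h0

/-- The law the computed-density chain DOES sample: `(3/7, 4/7)` — the normalised tilted law
`π₂ · u₂ / qc₂ ∝ (5/12, 5/9)`. [folklore] -/
theorem imhComputed₂_stationary_biased :
    IsStationary ![(3 : ℝ) / 7, 4 / 7] (imhComputedKernel u₂ qc₂ π₂) := by
  obtain ⟨h01, h10, h00, h11⟩ := imhComputedKernel₂_entries
  intro y
  fin_cases y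
  · simp only [Fin.sum_univ_two, Fin.zero_eta, Matrix.cons_val_zero, Matrix.cons_val_one, h00, h10]
    norm_num
  · simp only [Fin.sum_univ_two, Fin.mk_one, Matrix.cons_val_zero, Matrix.cons_val_one, h01, h11]
    norm_num

/-- The biased law is exactly the normalised tilted law of the general theorem. [folklore] -/
theorem imhComputed₂_tilted_normalised (x : Fin 2) :
    tilted u₂ qc₂ π₂ x / ∑ y, tilted u₂ qc₂ π₂ y = ![(3 : ℝ) / 7, 4 / 7] x := by
  fin_cases x <;>
    simp only [tilted, Fin.sum_univ_two, u₂_apply, qc₂_zero, qc₂_one, π₂_zero, π₂_one,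
      Fin.zero_eta, Fin.mk_one, Matrix.cons_val_zero, Matrix.cons_val_one] <;>
    norm_num

/-- Size of the defect: stationary weight of state `0` is `3/7` instead of `1/3`, a relative bias
of `2/7` (≈ 29 %) from a `±20 %` density error of opposite sign on the two states. [folklore] -/
theorem imhComputed₂_relative_bias : ((3 : ℝ) / 7 - 1 / 3) / (1 / 3) = 2 / 7 := by norm_num

/-- **Reweight mode has the identical bias**: the self-normalised reweighting limit
`noisyReweightLaw π₂ (u₂/qc₂)` is the same `(3/7, 4/7)` (printed counterpart for the stochastic
case: "a persistent bias in the reweighted estimates of observables that does not vanish even with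
an infinite number of samples", Peng–Gao, Nat. Commun. 16 (2025), of Hutchinson-estimated CNF
densities). [folklore] -/
theorem imhComputed₂_reweightLaw (x : Fin 2) :
    π₂ x * (u₂ x / qc₂ x) / ∑ y, π₂ y * (u₂ y / qc₂ y) = ![(3 : ℝ) / 7, 4 / 7] x := by
  rw [← tilted_normalised_eq_reweightLaw]
  exact imhComputed₂_tilted_normalised x

end Witness

/-! ## How large is the bias?  A uniform bound from the misfit ratio (gen 3, append 1)

The audit face of E9: if the misfit factor `g = q/q̂` is known to lie in `[m, M]` — e.g. from a
uniform bound `|log q̂ − log q| ≤ δ`, so that `M/m ≤ e^{2δ}` — then the law the sampler actually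
targets (the normalised tilted law, both exactness modes) is within `M/m − 1` (resp. `e^{2δ} − 1`)
of `π` in `ℓ¹`, hence every bounded observable is biased by at most `‖O‖_∞ (M/m − 1)`.  This is
what a step-halving bound on an ODE-integrated model density buys (R2-SCOPE.md §3 E9, AUDIT flag
`ode-density-unverified`): a bias CEILING, not exactness. -/

section Bound

variable {X : Type*} [Fintype X]

/-- **ℓ¹ bias bound for a tilted law.**  If `π` is a probability vector and the misfit factor
satisfies `0 < m ≤ g ≤ M` pointwise, then `Σ_x |π(x) g(x)/Σ_y π(y) g(y) − π(x)| ≤ M/m − 1`.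
(Each term is `π(x) · |g(x)/Z − 1|` with `Z = Σ π g ∈ [m, M]`, and `|g/Z − 1| ≤ (M − m)/m`.)
[folklore] -/
theorem sum_abs_tilted_sub_le {π g : X → ℝ} (hπ : ∀ x, 0 ≤ π x) (hπ1 : ∑ x, π x = 1)
    {m M : ℝ} (hm : 0 < m) (hg : ∀ x, m ≤ g x) (hG : ∀ x, g x ≤ M) :
    ∑ x, |π x * g x / (∑ y, π y * g y) - π x| ≤ M / m - 1 := by
  obtain ⟨x₀, -⟩ := Finset.nonempty_of_sum_ne_zero (s := (univ : Finset X)) (f := π)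
    (by rw [hπ1]; exact one_ne_zero)
  have hmM : m ≤ M := (hg x₀).trans (hG x₀)
  have hM : 0 < M := hm.trans_le hmM
  set Z := ∑ y, π y * g y with hZ
  have hZm : m ≤ Z := by
    calc m = ∑ y, π y * m := by rw [← sum_mul, hπ1, one_mul]
      _ ≤ Z := sum_le_sum fun y _ => mul_le_mul_of_nonneg_left (hg y) (hπ y)
  have hZM : Z ≤ M := by
    calc Z ≤ ∑ y, π y * M := sum_le_sum fun y _ => mul_le_mul_of_nonneg_left (hG y) (hπ y)
      _ = M := by rw [← sum_mul, hπ1, one_mul]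
  have hZ0 : 0 < Z := hm.trans_le hZm
  have hk : 0 ≤ M / m - 1 := sub_nonneg.mpr ((one_le_div hm).mpr hmM)
  have hkm : (M / m - 1) * m = M - m := by
    field_simp
  have hkZ : (M / m - 1) * m ≤ (M / m - 1) * Z := mul_le_mul_of_nonneg_left hZm hk
  have key : ∀ x, |π x * g x / Z - π x| ≤ π x * (M / m - 1) := by
    intro x
    have hx : π x * g x / Z - π x = π x * ((g x - Z) / Z) := by
      field_simp
    rw [hx, abs_mul, abs_of_nonneg (hπ x)]
    refine mul_le_mul_of_nonneg_left ?_ (hπ x)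
    rw [abs_div, abs_of_pos hZ0, div_le_iff₀ hZ0, abs_le]
    constructor
    · have h1 : Z - g x ≤ M - m := by linarith [hg x, hZM]
      linarith [h1, hkm, hkZ]
    · have h2 : g x - Z ≤ M - m := by linarith [hG x, hZm]
      linarith [h2, hkm, hkZ]
  calc ∑ x, |π x * g x / Z - π x| ≤ ∑ x, π x * (M / m - 1) := sum_le_sum fun x _ => key x
    _ = M / m - 1 := by rw [← sum_mul, hπ1, one_mul]

/-- **Log form** (the shape an audit uses): if `g > 0` and `|log g(x)| ≤ δ` for all `x` — e.g. a
uniform bound on the error of a computed model log-density — then the `ℓ¹` distance between the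
tilted law and `π` is at most `e^{2δ} − 1` (`≈ 2δ` for small `δ`).  [folklore] -/
theorem sum_abs_tilted_sub_le_exp {π g : X → ℝ} (hπ : ∀ x, 0 ≤ π x) (hπ1 : ∑ x, π x = 1)
    {δ : ℝ} (hg0 : ∀ x, 0 < g x) (hlog : ∀ x, |Real.log (g x)| ≤ δ) :
    ∑ x, |π x * g x / (∑ y, π y * g y) - π x| ≤ Real.exp (2 * δ) - 1 := by
  have hlo : ∀ x, Real.exp (-δ) ≤ g x := fun x => by
    have h := (abs_le.mp (hlog x)).1
    calc Real.exp (-δ) ≤ Real.exp (Real.log (g x)) := Real.exp_le_exp.mpr h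
      _ = g x := Real.exp_log (hg0 x)
  have hhi : ∀ x, g x ≤ Real.exp δ := fun x => by
    have h := (abs_le.mp (hlog x)).2
    calc g x = Real.exp (Real.log (g x)) := (Real.exp_log (hg0 x)).symm
      _ ≤ Real.exp δ := Real.exp_le_exp.mpr h
  have h := sum_abs_tilted_sub_le hπ hπ1 (Real.exp_pos (-δ)) hlo hhi
  have hratio : Real.exp δ / Real.exp (-δ) = Real.exp (2 * δ) := by
    rw [← Real.exp_sub]
    congr 1
    ring
  rwa [hratio] at h

/-- The witness saturates nothing but illustrates the bound: misfit `u₂/qc₂ = (5/4, 5/6)`, so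
`M/m − 1 = 1/2`, while the actual `ℓ¹` distance between `(3/7, 4/7)` and `(1/3, 2/3)` is `4/21`.
[folklore] -/
theorem imhComputed₂_l1_bias : |(3 : ℝ) / 7 - 1 / 3| + |(4 : ℝ) / 7 - 2 / 3| = 4 / 21 := by
  norm_num [abs_of_nonneg, abs_of_nonpos]

end Bound

end Summit.Ventures.LatticeQCDFlow.Exactness
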